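import Summits.HubbardSuperconductivity.HubbardSuperconductivity.Theorems.LiebTwinNoOnsiteODLROHartreeFockOnsiteCeiling
import HarnessLib

/-!
# Crux `NoOnsiteODLRO` (stmt-HubbardSuperconductivity-0933), line `Sketch` — the A-PRIORI SIZE of the reduced-BCS gain:
# `0 ≤ G_L(g) ≤ 2g·n²/L²` (the Hartree–Fock pairing energy), for `0 < 2g ≤ U`

Helper file of lead c3 (route `LiebTwin`; the `EnslavedA1g` copy of the crux is `Iff.rfl`-equal), serving
`--supports stmt-HubbardSuperconductivity-0933` (registered helper stub `stub_reducedBCSGainApriori`). The line's open core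
`stub_reducedBCSStability` asks that the sector-energy gain `G_L(g) := E_K(H_U) − E_K(H_U − (g/L²)·P_sᴴP_s)`
(`K = szSector (2n) 0`) be `o(L²)` for one fixed `g > 0`. This file records its a-priori size from landed pieces:

* `gain_nonneg` — `0 ≤ G_L(g)` for `g ≥ 0` (gain monotonicity `Theorems.NoOnsiteODLRO.ReducedBCS.gain_mono` at `0 ≤ g/L²`);
* `gain_le_hartreeFock` — **`G_L(g) ≤ 2g·n²/L²` for `0 < g`, `2g ≤ U`, `n ≤ L²`, `L ≥ 3`**: the repulsion absorbs the
  reduced attraction (`Theorems.NoOnsiteODLRO.ReducedChannel.minEnergyOn_hubbardTorus_shift_le`: `E_K(H_U − (g/L²)P_sᴴP_s) ≥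
  E_K(H_{U−2g})`), a ground state `φ` at the weaker coupling `U − 2g` is a trial state for `H_U`
  (`E(U) ≤ E(U−2g) + 2g⟨D⟩_φ`), and `⟨D⟩_φ ≤ n²/L²` (`Theorems.NoOnsiteODLRO.HartreeFock.re_expect_doublon_le_hartreeFock`,
  p160024; at `2g = U` directly `hartreeFockEnergyCeiling`, p158799).

So `G_L(g)/L² ∈ [ (g/L⁴)·max_GS S_L , 2g·(n/L²)² ]`: the core stub asks `o(1)` of a density that is a priori at most
`2g·ν²`, `ν = n/L² ≤ (1−δ)/2` — the "natural strength `O(L²)`" of the idea card, quantified; nothing in the tree narrows the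
bracket. Sources: B. S. Shastry, J. Phys. A 30 (1997) L635, eq. (1); D. R. Penn, Phys. Rev. 142 (1966) 350, §II; R. B.
Griffiths, J. Math. Phys. 5 (1964) 1215, §III; H. Tasaki (2020) §2.2. Folklore bookkeeping; no definition, no named fact.
-/

noncomputable section

set_option linter.dupNamespace false

namespace Summit.HubbardSuperconductivity.HubbardSuperconductivity.Theorems.NoOnsiteODLRO.ReducedBCS

open Matrix Finset
open Literature.Probability.LatticeModels Literature.MathematicalPhysics.QuantumLattice
open Literature.Barriers.HubbardSuperconductivity (exists_unit_isGroundStateInSector_hubbardTorus)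
open Summit.HubbardSuperconductivity.HubbardSuperconductivity.Theorems.NoOnsiteODLRO.ReducedChannel
  (minEnergyOn_hubbardTorus_shift_le minEnergyOn_mono_of_posSemidef_sub hubbardTorus_zero_one_eq_sum_doublon)
open Summit.HubbardSuperconductivity.HubbardSuperconductivity.Theorems.NoOnsiteODLRO.HartreeFock
  (hartreeFockEnergyCeiling re_expect_doublon_le_hartreeFock)
open scoped ComplexOrder

variable {L : ℕ} [NeZero L]

/-- **The gain is nonnegative**: for `g ≥ 0`, every real `U` and every sector `K`,
`E_K(H_U − (g/L²)·P_sᴴP_s) ≤ E_K(H_U)` (the subtracted term is positive semidefinite; Loewner monotonicity).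
Griffiths (1964) §III. [folklore] -/
theorem gain_nonneg (U : ℝ) {g : ℝ} (hg : 0 ≤ g) (K : Submodule ℂ (Fock (Orb (FermionTorus 2 L)))) :
    (hubbardTorus 2 L 1 U - ((g / (L : ℝ) ^ 2 : ℝ) : ℂ) • ((pairField sWave L)ᴴ * pairField sWave L)).minEnergyOn K ≤
      (hubbardTorus 2 L 1 U).minEnergyOn K := by
  have hH : (hubbardTorus 2 L 1 U).IsHermitian := LiebThm1.hamiltonian_isHermitian (fermionTorusGraph 2 L) 1 U
  set P := pairField sWave L
  have hPP : (Pᴴ * P).IsHermitian := isHermitian_conjTranspose_mul_self P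
  have hsm : (((g / (L : ℝ) ^ 2 : ℝ) : ℂ) • (Pᴴ * P)).IsHermitian := by
    unfold Matrix.IsHermitian
    rw [conjTranspose_smul, hPP.eq, Complex.star_def, Complex.conj_ofReal]
  refine minEnergyOn_mono_of_posSemidef_sub (hH.sub hsm) ?_ K
  rw [sub_sub_cancel]
  exact (posSemidef_conjTranspose_mul_self P).smul
    (Complex.zero_le_real.2 (div_nonneg hg (by positivity)))

/-- **A-priori size of the reduced-BCS gain: at most the Hartree–Fock pairing energy.** For `L ≥ 3`, `0 < g`,
`2g ≤ U` and `n ≤ L²`: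
`E_(2n,0)(H_U) − E_(2n,0)(H_U − (g/L²)·P_sᴴP_s) ≤ 2g·n²/L²`.
Proof: `E(H_U − (g/L²)P_sᴴP_s) ≥ E(H_{U−2g})` (absorption); if `2g < U`, a unit ground state `φ` of the sector at
coupling `U − 2g > 0` gives `E(U) ≤ E(U−2g) + 2g·Re⟨φ,Dφ⟩` and `Re⟨φ,Dφ⟩ ≤ n²/L²`; if `2g = U`, `E(U) − E(0) ≤ U n²/L²`
is the Hartree–Fock energy ceiling. Shastry (1997) eq. (1); Penn (1966) §II; Griffiths (1964) §III. [folklore] -/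
theorem gain_le_hartreeFock (hL : 3 ≤ L) {U g : ℝ} (hg : 0 < g) (hgU : 2 * g ≤ U) {n : ℕ} (hn : n ≤ L ^ 2) :
    (hubbardTorus 2 L 1 U).minEnergyOn (szSector (Λ := FermionTorus 2 L) (2 * n) 0) -
        (hubbardTorus 2 L 1 U -
            ((g / (L : ℝ) ^ 2 : ℝ) : ℂ) • ((pairField sWave L)ᴴ * pairField sWave L)).minEnergyOn
          (szSector (Λ := FermionTorus 2 L) (2 * n) 0) ≤
      2 * g * ((n : ℝ) ^ 2 / (L : ℝ) ^ 2) := by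
  set K := szSector (Λ := FermionTorus 2 L) (2 * n) 0 with hK
  have hL1 : (0 : ℝ) < (L : ℝ) := by exact_mod_cast Nat.pos_of_ne_zero (NeZero.ne L)
  have hL2 : (0 : ℝ) < (L : ℝ) ^ 2 := by positivity
  -- absorption: `E_K(H_{U-2g}) ≤ E_K(H_U − (g/L²)·P_sᴴP_s)`
  have habs := minEnergyOn_hubbardTorus_shift_le L U (g / (L : ℝ) ^ 2) (div_nonneg hg.le hL2.le) K
  have hshift : U - 2 * (L : ℝ) ^ 2 * (g / (L : ℝ) ^ 2) = U - 2 * g := by field_simp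
  rw [hshift] at habs
  -- the coupling difference `E(U) − E(U − 2g) ≤ 2g·n²/L²`
  have hdiff : (hubbardTorus 2 L 1 U).minEnergyOn K - (hubbardTorus 2 L 1 (U - 2 * g)).minEnergyOn K ≤
      2 * g * ((n : ℝ) ^ 2 / (L : ℝ) ^ 2) := by
    rcases hgU.lt_or_eq with hlt | heq
    · -- `2g < U`: a ground state at the weaker coupling `U − 2g > 0`
      have hU' : 0 < U - 2 * g := sub_pos.2 hlt
      obtain ⟨φ, hφ1, hφ⟩ := exists_unit_isGroundStateInSector_hubbardTorus (U - 2 * g) L n hn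
      have hd := re_expect_doublon_le_hartreeFock hL hU' hn hφ1 hφ
      obtain ⟨hφmem, -, hφeig⟩ := hφ
      have hH : (hubbardTorus 2 L 1 U).IsHermitian := LiebThm1.hamiltonian_isHermitian (fermionTorusGraph 2 L) 1 U
      have hφground : (star φ ⬝ᵥ (hubbardTorus 2 L 1 (U - 2 * g)) *ᵥ φ).re =
          (hubbardTorus 2 L 1 (U - 2 * g)).minEnergyOn K := by
        rw [hφeig, dotProduct_smul, hφ1, smul_eq_mul, mul_one, Complex.ofReal_re]
      have hvar := minEnergyOn_le_rayleigh_of_mem hH K hφmem hφ1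
      have hsplit : hubbardTorus 2 L 1 U =
          hubbardTorus 2 L 1 (U - 2 * g) + ((U - (U - 2 * g) : ℝ) : ℂ) • hubbardTorus 2 L 0 1 := by
        rw [hubbardTorus_eq_zero_add_smul_interaction (L := L) U,
          hubbardTorus_eq_zero_add_smul_interaction (L := L) (U - 2 * g), hubbardTorus_zero_one_eq_sum_doublon,
          add_assoc, ← add_smul]
        push_cast
        ring_nf
      have hexp : (star φ ⬝ᵥ (hubbardTorus 2 L 1 U) *ᵥ φ).re =
          (hubbardTorus 2 L 1 (U - 2 * g)).minEnergyOn K + (U - (U - 2 * g)) * (expect (hubbardTorus 2 L 0 1) φ).re := by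
        rw [hsplit, add_mulVec, dotProduct_add, Complex.add_re, hφground, smul_mulVec, dotProduct_smul,
          smul_eq_mul, Complex.re_ofReal_mul]
        rfl
      rw [hexp, sub_sub_cancel] at hvar
      have h2g : (0 : ℝ) ≤ 2 * g := by linarith
      nlinarith [mul_le_mul_of_nonneg_left hd h2g]
    · -- `2g = U`: the Hartree–Fock energy ceiling
      have hHF := hartreeFockEnergyCeiling hL U hn
      have h0 : U - 2 * g = 0 := by linarith
      rw [h0]
      change (hubbardTorus 2 L 1 U).minEnergyOn K ≤ (hubbardTorus 2 L 1 0).minEnergyOn K + _ at hHF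
      have hU2 : U * ((n : ℝ) ^ 2 / (L : ℝ) ^ 2) = 2 * g * ((n : ℝ) ^ 2 / (L : ℝ) ^ 2) := by rw [heq]
      linarith
  linarith

/-! ### Registered helper stub -/

/-- **Registered helper stub `stub_reducedBCSGainApriori`** of crux `NoOnsiteODLRO` (stmt-HubbardSuperconductivity-0933,
line `Sketch`; NOT a composition piece): the reduced-BCS gain is at most the Hartree–Fock pairing energy `2g·n²/L²`
for `0 < g`, `2g ≤ U` (`gain_le_hartreeFock` with all binders after the colon). [folklore] -/
theorem stub_reducedBCSGainApriori : open Literature.MathematicalPhysics.QuantumLattice Literature.Probability.LatticeModels in ∀ (L : ℕ) [NeZero L], 3 ≤ L → ∀ (U g : ℝ), 0 < g → 2 * g ≤ U → ∀ (n : ℕ), n ≤ L ^ 2 → (hubbardTorus 2 L 1 U).minEnergyOn (szSector (Λ := FermionTorus 2 L) (2 * n) 0) - (hubbardTorus 2 L 1 U - ((g / (L : ℝ) ^ 2 : ℝ) : ℂ) • ((pairField sWave L)ᴴ * pairField sWave L)).minEnergyOn (szSector (Λ := FermionTorus 2 L) (2 * n) 0) ≤ 2 * g * ((n : ℝ) ^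 2 / (L : ℝ) ^ 2) :=
  fun _ _ hL _ _ hg hgU _ hn => gain_le_hartreeFock hL hg hgU hn

end Summit.HubbardSuperconductivity.HubbardSuperconductivity.Theorems.NoOnsiteODLRO.ReducedBCS

end
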